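import Summits.MatrixMultiplication.MatrixMultiplication.Theorems.AbelianSTPPCensusVPCertBudget

/-!
# vP certificate, soundness of the `VPCert` checker (part 2: bound, admissibility test, kills, search, transport)

`VPCert.checkV_sound`: if `checkV M = true` then no `vM`-admissible shape multiset inside the universe all of whose realised
sub-lists pass U11-G (and U11-P at prime `M`) has Δ1 integer gain `> 10⁶·M`; and the transport to the tree statement,
`VPCert.shapeExclusionVP_of_checkV : checkV M = true → M ≤ 337 → (2 ≤ N → SieveAdmissibleVP M a b c → ¬ Beats (5/2) M a b c)`,
so that the registered stubs `stub_vp_128_207` / `stub_vp_208_337` of crux `ShapeExclusionVP337` (stmt-MatrixMultiplication-19191)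
follow from per-order evaluations `checkV M = true` alone (delta Δ5, not in this file).  Structure after eng-2's
`…ShapeCertSearch` / `…ShapeCertFinal`; new: the node kills (`killG_sound` / `killP_sound`, Δ3) and the vP packing budget in
the continuation bound (`AboveV.gsum_le` through `AboveV.tail_uu_le_qTot`, Δ4).
Cell mm-stpp, seat mm-stpp-vp-p2 (gen 0), 2026-08-26.
-/

set_option linter.dupNamespace false
set_option autoImplicit false

namespace Summit.MatrixMultiplication.MatrixMultiplication.Theorems.VPCert

open ShapeCert Multiset

section bound
/-! ### The continuation bound with the vP packing budget -/

variable {M : ℕ} {G : Multiset (ℕ × ℕ × ℕ)} {fam : List Sh}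

/-- the scaled ratio dominates gain over packing weight: `g·K ≤ rho·(ab+bc+ca)` -/
theorem rho_mul_geV {x : ℕ × ℕ × ℕ} (hU : InUniv M x) : gainOf337 (vol x) * K ≤ (shOfV M x).rho * uu x := by
  rw [shOfV_rho, Nat.add_mul, Nat.one_mul]
  exact (Nat.lt_div_mul_add hU.uu_pos).le

/-- every tail member fits the bucket `kOfq` of any valid packing budget `q` -/
theorem AboveV.tail_capOK (h : AboveV M G fam) {q : ℕ} (hq : ((G - famT fam).map uu).sum ≤ q)
    {x : ℕ × ℕ × ℕ} (hx : x ∈ G - famT fam) : capOK (kOfq (aggOf M fam) M q) (vol x) = true := by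
  have hxG := mem_G_of_tail hx
  have hU := h.univ x hxG
  obtain ⟨v1, v2, v3, v4⟩ := h.tail_vol hx
  have ux : uu x ≤ ((G - famT fam).map uu).sum := Multiset.le_sum_of_mem (Multiset.mem_map_of_mem uu hx)
  have w1 := Multiset.le_sum_of_mem (Multiset.mem_map_of_mem wa hx)
  have w2 := Multiset.le_sum_of_mem (Multiset.mem_map_of_mem wb hx)
  have w3 := Multiset.le_sum_of_mem (Multiset.mem_map_of_mem wc hx)
  have t1 := h.tail_wa; have t2 := h.tail_wb; have t3 := h.tail_wc
  unfold kOfq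
  refine capOK_min3 ?_ ?_ ?_
  · refine capOK_of_le ?_ (capOK_bucketOf _)
    unfold Agg.vl Agg.mc aggOf; simp only
    have : max (max (sab fam) (max (sbc fam) (sca fam))) (mxP fam) ≤ M - vol x :=
      max_le (max_le (by omega) (max_le (by omega) (by omega))) (by omega)
    omega
  · apply capOK_kU
    have h27 := vol_sq_le_uu_cube x
    have : uu x ^ 3 ≤ q ^ 3 := Nat.pow_le_pow_left (ux.trans hq) 3
    omega
  · apply capOK_kR
    have ha : wa x ≤ (aggOf M fam).ra M := by unfold Agg.ra aggOf; simp only; omega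
    have hb : wb x ≤ (aggOf M fam).rb M := by unfold Agg.rb aggOf; simp only; omega
    have hc : wc x ≤ (aggOf M fam).rc M := by unfold Agg.rc aggOf; simp only; omega
    have qa := hU.four_vol_le_wa_sq; have qb := hU.four_vol_le_wb_sq; have qc := hU.four_vol_le_wc_sq
    have ma := Nat.mul_self_le_mul_self ha; have mb := Nat.mul_self_le_mul_self hb
    have mc := Nat.mul_self_le_mul_self hc
    rcases min_choice ((aggOf M fam).rb M) ((aggOf M fam).rc M) with e | e <;> rw [e] <;>
      rcases min_choice ((aggOf M fam).ra M) _ with e' | e' <;> rw [e'] <;> omega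

/-- **The continuation bound.** Any vP-admissible family above the prefix whose tail lies in the pool `R` has Δ1 gain at
most the prefix gain plus `bndq` for any valid packing budget `q` (all scaled by `K`), `B` dominating the pool's ratios. -/
theorem AboveV.gsum_le (h : AboveV M G fam) {R : List Sh} {B : B8} {q : ℕ}
    (hR : ∀ x ∈ G - famT fam, shOfV M x ∈ R) (hB : ∀ t ∈ R, ∀ k, capOK k t.V = true → t.rho ≤ B.get k)
    (hq : ((G - famT fam).map uu).sum ≤ q) :
    gsum337 G * K ≤ gs fam * K + bndq (aggOf M fam) M q B := by
  have hsplit : gsum337 G = gs fam + gsum337 (G - famT fam) := by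
    unfold gsum337; rw [gs_eqV h.wf]; exact sum_map_split h.le _
  by_cases hd : (aggOf M fam).dead M = true
  · rw [hsplit, h.tail_eq_zero_of_dead hd]; simp [gsum337]
  rw [bndq, if_neg hd, hsplit, Nat.add_mul]
  apply Nat.add_le_add_left
  calc gsum337 (G - famT fam) * K
      = ((G - famT fam).map fun x => gainOf337 (vol x) * K).sum := by
        unfold gsum337; rw [Multiset.sum_map_mul_right]
    _ ≤ ((G - famT fam).map fun x => B.get (kOfq (aggOf M fam) M q) * uu x).sum := by
        apply Multiset.sum_map_le_sum_map
        intro x hx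
        have hU := h.univ x (mem_G_of_tail hx)
        refine (rho_mul_geV hU).trans (Nat.mul_le_mul_right _ ?_)
        exact hB _ (hR x hx) _ (by rw [shOfV_V]; exact h.tail_capOK hq hx)
    _ = B.get (kOfq (aggOf M fam) M q) * ((G - famT fam).map uu).sum := by rw [Multiset.sum_map_mul_left]
    _ ≤ B.get (kOfq (aggOf M fam) M q) * q := Nat.mul_le_mul_left _ hq

/-- no family through the prefix beats when prefix gain + bound `≤ 10⁶·M` -/
theorem AboveV.not_beat_of_le (h : AboveV M G fam) {R : List Sh} {B : B8} {q : ℕ}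
    (hR : ∀ x ∈ G - famT fam, shOfV M x ∈ R) (hB : ∀ t ∈ R, ∀ k, capOK k t.V = true → t.rho ≤ B.get k)
    (hq : ((G - famT fam).map uu).sum ≤ q) (hle : gs fam * K + bndq (aggOf M fam) M q B ≤ M * D * K) :
    ¬ M * D < gsum337 G := by
  have := (h.gsum_le hR hB hq).trans hle
  have := Nat.le_of_mul_le_mul_right this (show 0 < K by decide)
  omega

end bound

section feas
/-! ### The admissibility test accepts every admissible extension (eng-2's `feasA_complete`, for vP records) -/

variable {M : ℕ}

/-- **Completeness of the admissibility test** -/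
theorem feasA_completeV {t : Sh} {fam : List Sh} (h : AboveV M (famT (t :: fam)) (t :: fam)) :
    feasA M t (aggOf M fam) fam = true := by
  have hz : famT (t :: fam) - famT (t :: fam) = 0 := tsub_self _
  have u1 := h.tail_wa; have u2 := h.tail_wb; have u3 := h.tail_wc
  have p1 := h.tail_pab; have p2 := h.tail_pbc; have p3 := h.tail_pca
  rw [hz] at u1 u2 u3 p1 p2 p3
  simp only [Multiset.map_zero, Multiset.sum_zero, zero_add] at u1 u2 u3 p1 p2 p3
  obtain ⟨⟨q1, q2, q3⟩, -, h9, h14, hT⟩ := h.adm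
  have f1 := sab_eqV h.wf; have f2 := sbc_eqV h.wf; have f3 := sca_eqV h.wf
  unfold pabM at f1; unfold pbcM at f2; unfold pcaM at f3
  rw [← f1] at q1; rw [← f2] at q2; rw [← f3] at q3
  have htU : InUniv M t.tr := h.univ _ (tr_mem_famT (by simp))
  have h9a : ∀ l ∈ fam, t.mpp + l.V ≤ M ∧ l.mpp + t.V ≤ M := by
    intro l hl
    have hlF : l.tr ∈ famT (t :: fam) := tr_mem_famT (List.mem_cons_of_mem _ hl)
    have htF : t.tr ∈ famT (t :: fam) := tr_mem_famT (by simp)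
    have e1 : famT (t :: fam) = t.tr ::ₘ famT fam := rfl
    have m1 : l.tr ∈ (famT (t :: fam)).erase t.tr := by
      rw [e1, Multiset.erase_cons_head]; exact tr_mem_famT hl
    have m2 : t.tr ∈ (famT (t :: fam)).erase l.tr := by
      by_cases he : l.tr = t.tr
      · rw [he, e1, Multiset.erase_cons_head, ← he]; exact tr_mem_famT hl
      · rw [e1, Multiset.erase_cons_tail _ (Ne.symm he)] ; exact Multiset.mem_cons_self _ _
    have a := h9 t.tr htF l.tr m1
    have b := h9 l.tr hlF t.tr m2
    have wt := h.wf t (by simp); have wl := h.wf l (List.mem_cons_of_mem _ hl)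
    have em := congrArg Sh.mpp wt; have ev := congrArg Sh.V wt
    have em' := congrArg Sh.mpp wl; have ev' := congrArg Sh.V wl
    rw [shOfV_mpp] at em em'; rw [shOfV_V] at ev ev'
    constructor <;> omega
  have hT2 : ∀ l ∈ t :: fam, t2ok M (sab (t :: fam)) (sbc (t :: fam)) (sca (t :: fam)) l = true := by
    intro l hl
    have hlF : l.tr ∈ famT (t :: fam) := tr_mem_famT hl
    obtain ⟨x1, x2, x3⟩ := hT l.tr hlF
    have s1 := h.erase_split hl pab; have s2 := h.erase_split hl pbc; have s3 := h.erase_split hl pca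
    rw [hz] at s1 s2 s3
    simp only [Multiset.map_zero, Multiset.sum_zero, add_zero] at s1 s2 s3
    rw [← f1] at s1; rw [← f2] at s2; rw [← f3] at s3
    have hUl := h.univ _ hlF
    have v1 := hUl.pab_le_vol; have v2 := hUl.pbc_le_vol; have v3 := hUl.pca_le_vol
    have wl := h.wf l hl
    have eV := congrArg Sh.V wl; have eab := congrArg Sh.ab wl; have ebc := congrArg Sh.bc wl
    have eca := congrArg Sh.ca wl; have ea := congrArg Sh.a wl; have eb := congrArg Sh.b wl
    have ec := congrArg Sh.c wl
    rw [shOfV_V] at eV; rw [shOfV_ab] at eab; rw [shOfV_bc] at ebc; rw [shOfV_ca] at eca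
    rw [shOfV_a] at ea; rw [shOfV_b] at eb; rw [shOfV_c] at ec
    apply t2ok_of
    · intro ha hb; rw [eV, ea, ec]; exact x1 (by omega) (by omega)
    · intro ha hb; rw [eV, eb, ea]; exact x2 (by omega) (by omega)
    · intro ha hb; rw [eV, ec, eb]; exact x3 (by omega) (by omega)
  have hmpp := htU.mpp_le
  have hVt : t.V ≤ M := by
    have := htU.vol_le; have ev := congrArg Sh.V (h.wf t (by simp)); rw [shOfV_V] at ev; omega
  have emt := congrArg Sh.mpp (h.wf t (by simp)); rw [shOfV_mpp] at emt
  rw [feasA, Agg.force_eq, ← aggOf_cons]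
  unfold feasP
  simp only [aggOf, Bool.and_eq_true, decide_eq_true_eq, Bool.or_eq_true, List.all_eq_true, Bool.not_not]
  refine ⟨⟨⟨⟨⟨⟨⟨⟨⟨⟨u1, u2⟩, u3⟩, q1⟩, q2⟩, q3⟩, by omega⟩, by omega⟩, by omega⟩, ?_⟩, hT2⟩
  by_cases he : fam = []
  · left; simp [he]
  · right
    constructor
    · have : mxV fam ≤ M - t.mpp := mxV_le fun l hl => by have := (h9a l hl).1; omega
      omega
    · have : mxP fam ≤ M - t.V := mxP_le fun l hl => by have := (h9a l hl).2; omega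
      omega

end feas

section kills
/-! ### Δ3: the node kills are sound (a killed prefix violates U11-G resp. U11-P) -/

variable {M : ℕ} {fam : List Sh}

/-- a violation found by `violG` refutes `U11GFormBM` -/
theorem not_formB_of_violG {F : Multiset (ℕ × ℕ × ℕ)} {ub fl t : ℕ} (hub : ub = (F.map fun x => x.1 * x.2.2 * min t x.2.1).sum)
    (hfl : fl = lBM F t) (hv : violG M (pabM F) (pbcM F) (pcaM F) ub fl t = true) : ¬ U11GFormBM M F := by
  intro hG
  unfold violG at hv
  simp only [Bool.and_eq_true, Bool.or_eq_true, decide_eq_true_eq, beq_iff_eq] at hv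
  obtain ⟨⟨⟨⟨h2, hP1⟩, hP2⟩, hL⟩, hv⟩ := hv
  have hG' := hG t h2 hP1 hP2 (by rw [← hfl]; exact hL)
  have hu : ubBM M F t = ub + t * (M - pcaM F) := by rw [hub]; rfl
  rcases hv with ⟨rfl, hv⟩ | ⟨h3, hv⟩
  · have := hG'.1 rfl; rw [hu] at this; omega
  · have := hG'.2 h3; rw [hu] at this; omega

/-- a violation found by `violP` refutes `U11PFormBM` -/
theorem not_formB_of_violP {F : Multiset (ℕ × ℕ × ℕ)} {ub t : ℕ} (hub : ub = (F.map fun x => x.1 * x.2.2 * min t x.2.1).sum)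
    (hv : violP M (pabM F) (pbcM F) (pcaM F) ub t = true) : ¬ U11PFormBM M F := by
  intro hP
  unfold violP at hv
  simp only [Bool.and_eq_true, decide_eq_true_eq] at hv
  obtain ⟨⟨⟨h1, hP1⟩, hP2⟩, hv⟩ := hv
  have := hP t h1 hP1 hP2
  have hu : ubBM M F t = ub + t * (M - pcaM F) := by rw [hub]; rfl
  rw [hu] at this; omega

/-- the form-B ceiling head of the prefix -/
theorem ubB'_eq (hw : WfV M fam) (t : ℕ) : ubB' fam t = ((famT fam).map fun x => x.1 * x.2.2 * min t x.2.1).sum :=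
  agg_sum_eqV hw _ _ (fun _ => rfl)
/-- the form-A ceiling head of the prefix -/
theorem ubA'_eq (hw : WfV M fam) (t : ℕ) :
    ubA' fam t = (((famT fam).map rotA).map fun x => x.1 * x.2.2 * min t x.2.1).sum := by
  rw [Multiset.map_map]; exact agg_sum_eqV hw _ _ (fun _ => rfl)
/-- the form-C ceiling head of the prefix -/
theorem ubC'_eq (hw : WfV M fam) (t : ℕ) :
    ubC' fam t = (((famT fam).map rotC).map fun x => x.1 * x.2.2 * min t x.2.1).sum := by
  rw [Multiset.map_map]; exact agg_sum_eqV hw _ _ (fun _ => rfl)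
/-- the form-B fibre count of the prefix -/
theorem flB_eq (hw : WfV M fam) (t : ℕ) : flB fam t = lBM (famT fam) t := agg_sum_eqV hw _ _ (fun _ => rfl)
/-- the form-A fibre count of the prefix -/
theorem flA_eq (hw : WfV M fam) (t : ℕ) : flA fam t = lBM ((famT fam).map rotA) t := by
  unfold lBM; rw [Multiset.map_map]; exact agg_sum_eqV hw _ _ (fun _ => rfl)
/-- the form-C fibre count of the prefix -/
theorem flC_eq (hw : WfV M fam) (t : ℕ) : flC fam t = lBM ((famT fam).map rotC) t := by
  unfold lBM; rw [Multiset.map_map]; exact agg_sum_eqV hw _ _ (fun _ => rfl)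

/-- **the U11-G kill is sound**: a killed prefix violates U11-G in some letter form -/
theorem killG_sound (hw : WfV M fam) (hk : killG M (aggOf M fam) fam = true) : ¬ U11GM M (famT fam) := by
  intro hG
  unfold killG at hk
  simp only [seqN_eq, aggOf, Bool.and_eq_true, Bool.or_eq_true, List.any_eq_true, decide_eq_true_eq] at hk
  obtain ⟨-, hk⟩ := hk
  rw [sab_eqV hw, sbc_eqV hw, sca_eqV hw] at hk
  rcases hk with (⟨t, -, hv⟩ | ⟨t, -, hv⟩) | ⟨t, -, hv⟩
  · exact not_formB_of_violG (ubB'_eq hw t) (flB_eq hw t) hv hG.1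
  · exact not_formB_of_violG (ubA'_eq hw t) (flA_eq hw t) (by rwa [pabM_rotA, pbcM_rotA, pcaM_rotA]) hG.2.1
  · exact not_formB_of_violG (ubC'_eq hw t) (flC_eq hw t) (by rwa [pabM_rotC, pbcM_rotC, pcaM_rotC]) hG.2.2

/-- **the U11-P kill is sound**: a killed prefix violates U11-P in some letter form -/
theorem killP_sound (hw : WfV M fam) (hk : killP M (aggOf M fam) fam = true) : ¬ U11PM M (famT fam) := by
  intro hP
  unfold killP at hk
  simp only [seqN_eq, aggOf, Bool.and_eq_true, Bool.or_eq_true, List.any_eq_true, decide_eq_true_eq] at hk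
  obtain ⟨-, hk⟩ := hk
  rw [sab_eqV hw, sbc_eqV hw, sca_eqV hw] at hk
  rcases hk with (⟨t, -, hv⟩ | ⟨t, -, hv⟩) | ⟨t, -, hv⟩
  · exact not_formB_of_violP (ubB'_eq hw t) hv hP.1
  · exact not_formB_of_violP (ubA'_eq hw t) (by rwa [pabM_rotA, pbcM_rotA, pcaM_rotA]) hP.2.1
  · exact not_formB_of_violP (ubC'_eq hw t) (by rwa [pabM_rotC, pbcM_rotC, pcaM_rotC]) hP.2.2

/-- **the node kill is sound**: no vP-admissible family lies above a killed prefix -/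
theorem AboveV.not_kill {G : Multiset (ℕ × ℕ × ℕ)} (h : AboveV M G fam) {isP : Bool} (hP : isP = true → M.Prime)
    (hk : killV M isP (aggOf M fam) fam = true) : False := by
  have hvp := h.vp (fam.map Sh.tr) h.le
  unfold killV at hk
  rw [Bool.or_eq_true, Bool.and_eq_true] at hk
  rcases hk with hk | ⟨hi, hk⟩
  · exact killG_sound h.wf hk hvp.1
  · exact killP_sound h.wf hk (hvp.2 (hP hi))

end kills

section search
/-! ### The search is sound -/

variable {M : ℕ}

/-- What the search below the prefix `fam` with pool `R` guarantees: no vP-admissible beating family. -/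
def GoalV (M : ℕ) (fam R : List Sh) : Prop :=
  ∀ G : Multiset (ℕ × ℕ × ℕ), AboveV M G fam → M * D < gsum337 G → (∀ x ∈ G - famT fam, shOfV M x ∈ R) → False

/-- one unfolding of `dfsV` -/
theorem dfsV_succ (M : ℕ) (isP : Bool) (n : ℕ) (fam : List Sh) (L : List (Sh × Dec)) :
    dfsV M isP (n + 1) fam L =
      (if killV M isP (aggOf M fam) fam then true
       else if M * D < gs fam then false
       else if (aggOf M fam).dead M then true
       else loopV M (dfsV M isP n) fam (aggV M fam) ((aggOf M fam).ra M) ((aggOf M fam).rb M)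
          ((aggOf M fam).rc M) ((aggOf M fam).vl M) (gs fam * K) ((aggV M fam).qTot (headD L) M isP)
          (selOf (kOfq (aggOf M fam) M ((aggV M fam).qTot (headD L) M isP))) (M * D * K) L) := by
  simp only [dfsV, AggV.force_eq, seqN_eq]; rfl

/-- a goal with no tail member left in the pool -/
theorem goalV_of_pool_empty {fam : List Sh} (hnb : ¬ M * D < gs fam) {G : Multiset (ℕ × ℕ × ℕ)}
    (hG : AboveV M G fam) (hbeat : M * D < gsum337 G) (h0 : G - famT fam = 0) : False := by
  have : gsum337 G = gs fam := by
    unfold gsum337; rw [gs_eqV hG.wf, sum_map_split hG.le, h0]; simp [gsum337]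
  omega

/-- **Soundness of one level of the walk** (induction on the pool) -/
theorem loopV_sound (M : ℕ) (isP : Bool) (hP : isP = true → M.Prime) (n : ℕ) (fam : List Sh) (hwf : WfV M fam)
    (IH : ∀ fam' R', WfV M fam' → WfV M R' → (∀ t ∈ R', InUniv M t.tr) →
      dfsV M isP n fam' (sufDec R') = true → GoalV M fam' R')
    (hnb : ¬ M * D < gs fam) (hnd : ¬ (aggOf M fam).dead M = true) (R₀ : List Sh)
    (q : ℕ) (hq : ∀ G, AboveV M G fam → (∀ x ∈ G - famT fam, shOfV M x ∈ R₀) → ((G - famT fam).map uu).sum ≤ q) :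
    ∀ R : List Sh, (∀ s, s ∈ R → s ∈ R₀) → WfV M R → (∀ t ∈ R, InUniv M t.tr) →
      loopV M (dfsV M isP n) fam (aggV M fam) ((aggOf M fam).ra M) ((aggOf M fam).rb M) ((aggOf M fam).rc M)
        ((aggOf M fam).vl M) (gs fam * K) q (selOf (kOfq (aggOf M fam) M q)) (M * D * K)
        (sufDec R) = true → GoalV M fam R
  | [], _, _, _, _ => by
    intro G hG hbeat hpool
    exact goalV_of_pool_empty hnb hG hbeat
      (Multiset.eq_zero_of_forall_notMem fun x hx => by simpa using hpool x hx)
  | t :: R', hsub, hwR, hUR, hloop => by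
    intro G hG hbeat hpool
    have hwR' : WfV M R' := fun s hs => hwR s (List.mem_cons_of_mem _ hs)
    have hUR' : ∀ s ∈ R', InUniv M s.tr := fun s hs => hUR s (List.mem_cons_of_mem _ hs)
    have hsub' : ∀ s, s ∈ R' → s ∈ R₀ := fun s hs => hsub s (List.mem_cons_of_mem _ hs)
    have hdom : ∀ s ∈ t :: R', ∀ k, capOK k s.V = true → s.rho ≤ (dvec t R').B.get k := by
      intro s hs k hk; have := sufDec_dom (t :: R') s hs k hk; rwa [sufDec_cons] at this
    have hqG : ((G - famT fam).map uu).sum ≤ q := hq G hG fun x hx => hsub _ (hpool x hx)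
    rw [sufDec_cons] at hloop
    simp only [loopV] at hloop
    by_cases hbr : gs fam * K + selOf (kOfq (aggOf M fam) M q) (dvec t R').B * q ≤ M * D * K
    · exfalso
      refine hG.not_beat_of_le hpool hdom hqG ?_ hbeat
      rw [bndq, if_neg hnd, ← selOf_eq]; exact hbr
    rw [if_neg hbr] at hloop
    have hpool' : t.tr ∉ G - famT fam → ∀ x ∈ G - famT fam, shOfV M x ∈ R' := by
      intro ht x hx
      rcases List.mem_cons.mp (hpool x hx) with he | he
      · exfalso; apply ht; rw [← he, shOfV_tr]; exact hx
      · exact he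
    by_cases hch : (aggOf M fam).ra M < t.wA ∨ (aggOf M fam).rb M < t.wB ∨ (aggOf M fam).rc M < t.wC ∨
        (aggOf M fam).vl M < t.V
    · rw [aggV_A, if_pos hch] at hloop
      refine loopV_sound M isP hP n fam hwf IH hnb hnd R₀ q hq R' hsub' hwR' hUR' hloop G hG hbeat
        (hpool' fun hx => ?_)
      have hU := hG.univ _ (mem_G_of_tail hx)
      have w1 := Multiset.le_sum_of_mem (Multiset.mem_map_of_mem wa hx)
      have w2 := Multiset.le_sum_of_mem (Multiset.mem_map_of_mem wb hx)
      have w3 := Multiset.le_sum_of_mem (Multiset.mem_map_of_mem wc hx)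
      have t1 := hG.tail_wa; have t2 := hG.tail_wb; have t3 := hG.tail_wc
      obtain ⟨v1, v2, v3, v4⟩ := hG.tail_vol hx
      have wt := hwR t (by simp)
      have ea := congrArg Sh.wA wt; have eb := congrArg Sh.wB wt; have ec := congrArg Sh.wC wt
      have ev := congrArg Sh.V wt
      rw [shOfV_wA] at ea; rw [shOfV_wB] at eb; rw [shOfV_wC] at ec; rw [shOfV_V] at ev
      unfold Agg.ra Agg.rb Agg.rc Agg.vl Agg.mc aggOf at hch; simp only at hch
      have hm : max (max (sab fam) (max (sbc fam) (sca fam))) (mxP fam) ≤ M - vol t.tr :=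
        max_le (max_le (by omega) (max_le (by omega) (by omega))) (by omega)
      omega
    rw [aggV_A, if_neg hch, Bool.and_eq_true] at hloop
    obtain ⟨hstep, hrest⟩ := hloop
    by_cases hx : t.tr ∈ G - famT fam
    · have hwf1 : WfV M (t :: fam) := by
        intro s hs; rcases List.mem_cons.mp hs with rfl | hs
        · exact hwR s (by simp)
        · exact hwf s hs
      have hle1 : famT (t :: fam) ≤ G := cons_le_of_mem_sub hG.le hx
      have hG1 : AboveV M G (t :: fam) := ⟨hG.univ, hG.adm, hG.vp, hwf1, hle1⟩
      have hF : AboveV M (famT (t :: fam)) (t :: fam) :=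
        ⟨fun x hx' => hG.univ x (Multiset.mem_of_le hle1 hx'), hG.adm.mono hle1,
          fun L hL => hG.vp L (hL.trans hle1), hwf1, le_rfl⟩
      rw [feasA_completeV hF] at hstep
      simp only [if_true] at hstep
      have hpool1 : ∀ x ∈ G - famT (t :: fam), shOfV M x ∈ t :: R' :=
        fun x hx' => hpool x (Multiset.mem_of_le (sub_cons_le _ _ _) hx')
      rw [← sufDec_cons] at hstep
      exact IH (t :: fam) (t :: R') hwf1 hwR hUR hstep G hG1 hbeat hpool1
    · exact loopV_sound M isP hP n fam hwf IH hnb hnd R₀ q hq R' hsub' hwR' hUR' hrest G hG hbeat (hpool' hx)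

/-- **Soundness of the search** (induction on the fuel) -/
theorem dfsV_sound (M : ℕ) (isP : Bool) (hP : isP = true → M.Prime) :
    ∀ (n : ℕ) (fam R : List Sh), WfV M fam → WfV M R → (∀ t ∈ R, InUniv M t.tr) →
    dfsV M isP n fam (sufDec R) = true → GoalV M fam R
  | 0, fam, R, _, _, _, h => by simp [dfsV] at h
  | n + 1, fam, R, hwf, hwR, hUR, h => by
    rw [dfsV_succ] at h
    intro G hG hbeat hpool
    by_cases hk : killV M isP (aggOf M fam) fam = true
    · exact hG.not_kill hP hk
    rw [if_neg hk] at h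
    by_cases hb : M * D < gs fam
    · rw [if_pos hb] at h; exact Bool.false_ne_true h
    rw [if_neg hb] at h
    by_cases hd : (aggOf M fam).dead M = true
    · exact goalV_of_pool_empty hb hG hbeat (hG.tail_eq_zero_of_dead hd)
    rw [if_neg hd] at h
    exact loopV_sound M isP hP n fam hwf (fun fam' R' => dfsV_sound M isP hP n fam' R') hb hd R
      ((aggV M fam).qTot (headD (sufDec R)) M isP) (fun G' hG' hR' => hG'.tail_uu_le_qTot hR' hP)
      R (fun _ hs => hs) hwR hUR h G hG hbeat hpool

/-- **Soundness of the checker.** If `checkV M` succeeds, no `vM`-admissible shape multiset inside the universe, all of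
whose realised sub-lists pass U11-G (and U11-P when `M` is prime), has Δ1 integer gain above `10⁶·M`. -/
theorem checkV_sound {M : ℕ} (h : checkV M = true) (G : Multiset (ℕ × ℕ × ℕ))
    (hU : ∀ x ∈ G, InUniv M x) (hA : AdmM M G)
    (hVP : ∀ L : List (ℕ × ℕ × ℕ), (L : Multiset (ℕ × ℕ × ℕ)) ≤ G → U11GM M L ∧ (M.Prime → U11PM M L))
    (hbeat : M * D < gsum337 G) : False := by
  unfold checkV at h
  have key : ∀ isP : Bool, (isP = true → M.Prime) → dfsV M isP (M + 2) [] (sufDec (univV M)) = true → False :=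
    fun isP hP hd => dfsV_sound M isP hP (M + 2) [] (univV M) (fun _ h => by simp at h) (univV_wf M)
      (univV_inUniv M) hd G ⟨hU, hA, hVP, fun _ h => by simp at h, by simp [famT]⟩ hbeat
      (fun x hx => shOfV_mem_univV (hU x (mem_G_of_tail hx)))
  cases hp : decide (Nat.Prime M)
  · rw [hp] at h; exact key false (fun h' => Bool.noConfusion h') h
  · rw [hp] at h; exact key true (fun _ => of_decide_eq_true hp) h

end search

end Summit.MatrixMultiplication.MatrixMultiplication.Theorems.VPCert
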